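import Literature.AlgebraicGeometry.Resolution.RoofKChartOne
import Literature.AlgebraicGeometry.Resolution.EtaleChartOfRoot
import Literature.AlgebraicGeometry.Resolution.DChartRoof
import HarnessLib

/-!
# The roof datum — III. The second Hensel chart (the centre `a`), the constants, the chart `T_A`

Topic: `Literature/AlgebraicGeometry/Resolution`. M. Temkin, *Inseparable local uniformization*,
J. Algebra 373 (2013) = arXiv:0804.1554v3, Thm. 3.3.1, smooth-fibre case (tree:
`Temkin2013RelativeCurveSmoothFibre`). Continuing `RoofKChartOne.lean` for a roof datum
`D : RoofDatum k K L₁ Ω`: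

* over the integrally closed domain `T₁` the Hensel polynomial `H` of the disc coordinate
  (coefficients in `N″ ⊆ T₁`) has the simple root `x′ = (x − a)/c` with `|H′(x′)|_V = 1`
  (`SplitDiscNewton.henselPoly_discCoordinate`), so `EtaleChartOfRoot.exists_etaleChart_of_root`
  gives an ÉTALE `T₁`-subalgebra `T₂ = T₁[x′, u₂] ⊆ O_V` containing `x′` and hence the centre
  `a = x − c x′` — `RoofDatum.T₂`, `.u₂`, `a_mem_T₂` — PROVED;
* the constants `m = k(y₀, a)`: every `z ∈ m` has a fraction form `d z ∈ T₂`, `d ∈ k° ∖ 0`; a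
  SEPARATING CONSTANT `μ ∈ m ∩ O_V^×` (`SeparatingConstant.lean`) lies in `T₂`, and after
  inverting it every valuation ring over the chart contains `m` or induces `m ∩ O_V` on it, so
  `m° = O_V ∩ m ⊆ T₃ = T₂[1/μ]` (valuative membership, `EtaleChartNormal.lean`) — PROVED;
* `RoofDatum.TA = T₃[1/u_E]` — **the `K`-side chart**: smooth over `N`, contained in `O_V`,
  containing `m°`, `x′`, `u_E⁻¹`, hence the disc chart `B = m°[x′][1/u_E]` and with it the
  coefficients of the monic `f`, so that `η` (integral over `T_A`, with the fraction form
  `n η ∈ N[y₀, a]`) lies in `T_A`; and `T_A` lies in every subring containing `N″`, `z₀`, `u₁`,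
  `x′`, `u₂`, `μ⁻¹`, `u_E⁻¹` — PROVED.

Everything is [folklore] bookkeeping over the cited files; no named facts.

## Sources

* M. Temkin, arXiv:0804.1554v3, proof of Thm. 3.3.1, Steps 2–4 (pp. 44–45); Lemma 3.1.3.
  [Temkin2013]
-/

noncomputable section

open Polynomial IsLocalRing

namespace Literature.AlgebraicGeometry.Resolution

namespace RoofDatum

universe u

variable {k K L₁ Ω : Type u} [Field k] [Field K] [Field L₁] [Field Ω]
  [Algebra k K] [Algebra K L₁] [Algebra k L₁] [IsScalarTower k K L₁]
  [Algebra L₁ Ω] [Algebra k Ω] [IsScalarTower k L₁ Ω] [FiniteDimensional K L₁]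
  (D : RoofDatum k K L₁ Ω)

/-! ### The base ring `R₂ = T₁` of the second chart, as a subring of `Ω`

(The second chart is built over the SUBRING `T₁ ⊆ Ω` rather than over the `N″`-subalgebra `T₁`:
its elements then carry the ring structure of a subring of `Ω`, which keeps the instance paths of
the iterated subalgebras short.) -/

/-- `R₂ = T₁` as a subring of `Ω`. [folklore] -/
def R₂ : Subring Ω := D.T₁.toSubring

/-- Membership in `R₂` is membership in `T₁`. [folklore] -/
theorem mem_R₂_iff {w : Ω} : w ∈ D.R₂ ↔ w ∈ D.T₁ := Iff.rfl

/-- `R₂ ≅ T₁` (same elements). [folklore] -/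
def eR₂ : D.T₁ ≃+* D.R₂ :=
  { toFun := fun z => ⟨z.1, z.2⟩
    invFun := fun z => ⟨z.1, z.2⟩
    left_inv := fun _ => rfl
    right_inv := fun _ => rfl
    map_mul' := fun _ _ => rfl
    map_add' := fun _ _ => rfl }

/-- `R₂` is integrally closed. [folklore] -/
theorem isIntegrallyClosed_R₂ : IsIntegrallyClosed D.R₂ :=
  IsIntegrallyClosed.of_equiv (R := D.T₁) (h := D.isIntegrallyClosed_T₁) D.eR₂

/-- `R₂ ⊆ O_V`. [folklore] -/
theorem R₂_le_V : D.R₂ ≤ D.V.toSubring := D.T₁_le_V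

/-- `R₂ → O_V` elementwise. [folklore] -/
theorem algebraMap_R₂_mem_V (r : D.R₂) : algebraMap D.R₂ Ω r ∈ D.V := D.R₂_le_V r.2

/-! ### The Hensel polynomial of the disc coordinate over `R₂` -/

/-- `P` over `Ω`. [folklore] -/
def PΩ : Polynomial Ω := D.P.map (algebraMap k Ω)

/-- The Hensel polynomial `H` of the disc coordinate, over `Ω`. [folklore] -/
def HΩ : Polynomial Ω := discHenselPoly D.PΩ D.cΩ D.xΩ

/-- `PΩ(a) = 0`. [folklore] -/
theorem eval_PΩ_a : D.PΩ.eval D.a = 0 := by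
  rw [PΩ, eval_map, ← aeval_def]
  exact D.hPa

/-- `PΩ′(a) ≠ 0`. [folklore] -/
theorem eval_derivative_PΩ_a_ne_zero : (derivative D.PΩ).eval D.a ≠ 0 := by
  rw [PΩ, derivative_map, eval_map, ← aeval_def]
  exact D.hPa'

/-- The other roots of `PΩ` are far from `a`. [folklore] -/
theorem far_roots_PΩ (ρ : Ω) (hρ : D.PΩ.IsRoot ρ) (hρa : ρ ≠ D.a) :
    D.V.valuation D.cΩ < D.V.valuation (D.a - ρ) := by
  refine D.hfar ρ ?_ hρa
  rw [aeval_def, ← eval_map]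
  exact hρ

/-! ### The separating constant `μ` of `m = k(y₀, a)` (no chart needed) -/

/-- `k°` is maximal among the proper valuation rings of `k` (height one). [folklore] -/
theorem Ok_max : ∀ S : ValuationSubring k, D.Ok ≤ S → S = D.Ok ∨ S = ⊤ := by
  haveI : Ring.KrullDimLE 1 D.Ok := (Ring.krullDimLE_iff (R := D.Ok)).mpr (by
    rw [D.hdimk]; exact le_rfl)
  intro S h1
  exact (ValuationSubring.eq_self_or_eq_top_of_le h1).imp Eq.symm id

/-- The valuation ring `O_V ∩ m` of the constant field, on the type `m`. [folklore] -/
def OmV : ValuationSubring D.m := D.V.comap (algebraMap D.m Ω)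

/-- `O_V ∩ m` induces `k°`. [folklore] -/
theorem OmV_comap : D.OmV.comap (algebraMap k D.m) = D.Ok := by
  rw [OmV, ValuationSubring.comap_comap, ← IsScalarTower.algebraMap_eq, D.comap_k]

/-- **The separating constant.** An element `μ ∈ m` with `|μ|_V = 1`, lying in every valuation
ring containing `k°`, such that every valuation ring `W ⊇ k°` of `Ω` in which `μ` is a unit
either contains `m` or induces `m ∩ O_V` on `m`. [folklore] -/
theorem exists_μ : ∃ μ : Ω, μ ∈ D.m ∧ D.V.valuation μ = 1 ∧
    (∀ W : ValuationSubring Ω, (∀ c₀ ∈ D.Ok, algebraMap k Ω c₀ ∈ W) → μ ∈ W) ∧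
    ∀ W : ValuationSubring Ω, (∀ c₀ ∈ D.Ok, algebraMap k Ω c₀ ∈ W) → W.valuation μ = 1 →
      (∀ z ∈ D.m, z ∈ W) ∨ (∀ z ∈ D.m, z ∈ W ↔ z ∈ D.V) := by
  obtain ⟨μl, hμU, hμ1, hμlt⟩ := exists_separating_unit D.Ok D.OmV D.OmV_comap
  have hmemU : ∀ W : ValuationSubring Ω, (∀ c₀ ∈ D.Ok, algebraMap k Ω c₀ ∈ W) →
      D.Ok ≤ (W.comap (algebraMap D.m Ω)).comap (algebraMap k D.m) := by
    intro W hW c₀ hc₀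
    change algebraMap D.m Ω (algebraMap k D.m c₀) ∈ W
    rw [← IsScalarTower.algebraMap_apply]
    exact hW c₀ hc₀
  refine ⟨(μl : Ω), μl.2, ?_, fun W hW => hμU _ (hmemU W hW), fun W hW hWμ => ?_⟩
  · -- `|μ|_V = 1`
    have h1 : (μl : Ω) ∈ D.V := (D.OmV.valuation_le_one_iff _).mp hμ1.le
    have h2 : ((μl : Ω))⁻¹ ∈ D.V := by
      have : μl⁻¹ ∈ D.OmV := (D.OmV.valuation_le_one_iff _).mp (by rw [map_inv₀, hμ1, inv_one])
      exact this
    have hμ0 : (μl : Ω) ≠ 0 := fun h0 => by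
      have : μl = 0 := Subtype.ext h0
      rw [this, map_zero] at hμ1
      exact zero_ne_one hμ1
    refine le_antisymm ((D.V.valuation_le_one_iff _).mpr h1) ?_
    have h3 := (D.V.valuation_le_one_iff _).mpr h2
    rwa [map_inv₀, inv_le_one₀ ((Valuation.pos_iff _).mpr hμ0)] at h3
  · -- the dichotomy
    set U : ValuationSubring D.m := W.comap (algebraMap D.m Ω) with hU
    have hμ0 : (μl : Ω) ≠ 0 := fun h0 => by rw [h0, map_zero] at hWμ; exact zero_ne_one hWμ
    have hμl0 : μl ≠ 0 := fun h0 => hμ0 (by rw [h0]; rfl)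
    have hUμ : U.valuation μl = 1 := by
      have h1 : μl ∈ U := (W.valuation_le_one_iff _).mp hWμ.le
      have h2 : μl⁻¹ ∈ U :=
        (W.valuation_le_one_iff _).mp (by
          change W.valuation ((μl : Ω))⁻¹ ≤ 1
          rw [map_inv₀, hWμ, inv_one])
      refine le_antisymm ((U.valuation_le_one_iff _).mpr h1) ?_
      have h3 := (U.valuation_le_one_iff _).mpr h2
      rwa [map_inv₀, inv_le_one₀ ((Valuation.pos_iff _).mpr hμl0)] at h3
    rcases eq_or_eq_top_of_valuation_eq_one D.Ok_max hμlt U (hmemU W hW) hUμ with hUW | hUtop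
    · right
      intro z hz
      change ((⟨z, hz⟩ : D.m) : Ω) ∈ W ↔ ((⟨z, hz⟩ : D.m) : Ω) ∈ D.V
      change (⟨z, hz⟩ : D.m) ∈ U ↔ (⟨z, hz⟩ : D.m) ∈ D.OmV
      rw [hUW]
    · left
      intro z hz
      have : (⟨z, hz⟩ : D.m) ∈ U := by rw [hUtop]; exact ValuationSubring.mem_top _
      exact this

/-- The separating constant `μ`. [folklore] -/
def μ : Ω := D.exists_μ.choose

/-- `μ ∈ m`. [folklore] -/
theorem μ_mem_m : D.μ ∈ D.m := D.exists_μ.choose_spec.1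

/-- `|μ| = 1`. [folklore] -/
theorem valuation_μ : D.V.valuation D.μ = 1 := D.exists_μ.choose_spec.2.1

/-- `μ` lies in every valuation ring containing `k°`. [folklore] -/
theorem μ_mem_of (W : ValuationSubring Ω) (hW : ∀ c₀ ∈ D.Ok, algebraMap k Ω c₀ ∈ W) : D.μ ∈ W :=
  D.exists_μ.choose_spec.2.2.1 W hW

/-- The dichotomy for valuation rings in which `μ` is a unit. [folklore] -/
theorem μ_dichotomy (W : ValuationSubring Ω) (hW : ∀ c₀ ∈ D.Ok, algebraMap k Ω c₀ ∈ W)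
    (hWμ : W.valuation D.μ = 1) : (∀ z ∈ D.m, z ∈ W) ∨ (∀ z ∈ D.m, z ∈ W ↔ z ∈ D.V) :=
  D.exists_μ.choose_spec.2.2.2 W hW hWμ

/-- `μ ≠ 0`. [folklore] -/
theorem μ_ne_zero : D.μ ≠ 0 := fun h0 => by
  have h := D.valuation_μ
  rw [h0, map_zero] at h
  exact zero_ne_one h

/-- `μ ∈ O_V ∩ m`. [folklore] -/
theorem μ_mem_Om : D.μ ∈ D.Om :=
  D.mem_Om_iff.mpr ⟨(D.V.valuation_le_one_iff _).mp D.valuation_μ.le, D.μ_mem_m⟩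

/-- The coefficients of `H` lie in `R₂ = T₁`. [folklore] -/
theorem coeff_HΩ_mem_R₂ (j : ℕ) : D.HΩ.coeff j ∈ D.R₂ :=
  D.mem_T₁_of_mem_N'' (D.coeff_H_mem_N'' j)

/-- `H` lifts to `R₂`. [folklore] -/
theorem exists_HR : ∃ HR : Polynomial D.R₂, HR.map (algebraMap D.R₂ Ω) = D.HΩ := by
  have hl : D.HΩ ∈ Polynomial.lifts (algebraMap D.R₂ Ω) := by
    refine (Polynomial.lifts_iff_coeff_lifts _).mpr fun n => ?_
    exact ⟨⟨D.HΩ.coeff n, D.coeff_HΩ_mem_R₂ n⟩, rfl⟩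
  exact (Polynomial.mem_lifts _).mp hl

/-- `H` over `R₂`. [folklore] -/
def HR : Polynomial D.R₂ := D.exists_HR.choose

/-- `HR ↦ HΩ`. [folklore] -/
theorem HR_map : D.HR.map (algebraMap D.R₂ Ω) = D.HΩ := D.exists_HR.choose_spec

/-- `HR′(x′) = HΩ′(x′)`. [folklore] -/
theorem aeval_x'_derivative_HR : aeval D.x' (derivative D.HR) = (derivative D.HΩ).eval D.x' := by
  rw [aeval_def, ← eval_map, ← derivative_map, D.HR_map]

/-- `u_E ≠ 0`. [folklore] -/
theorem uE_ne_zero : D.uE ≠ 0 := fun h0 => by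
  have h := D.hvuE
  rw [h0, map_zero] at h
  exact zero_ne_one h

section AlgClosed

variable [IsAlgClosed Ω]

/-- **The Hensel data of the disc coordinate** (`SplitDiscNewton.henselPoly_discCoordinate` for
the datum): `H(x′) = 0`, all coefficients of `H` have value `≤ 1`, `|H′(x′)| = 1`. [folklore] -/
theorem henselData :
    D.HΩ.eval D.x' = 0 ∧ (∀ j, D.V.valuation (D.HΩ.coeff j) ≤ 1) ∧
      D.V.valuation ((derivative D.HΩ).eval D.x') = 1 := by
  have key := henselPoly_discCoordinate D.V D.cΩ_ne_zero (P := D.PΩ) D.eval_PΩ_a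
    D.eval_derivative_PΩ_a_ne_zero D.far_roots_PΩ D.hxa
  obtain ⟨-, -, hrest⟩ := key
  have hrest' : D.HΩ.eval D.x' = 0 ∧ D.HΩ.coeff 1 = 1 ∧
      D.V.valuation (D.HΩ.coeff 0) = D.V.valuation D.x' ∧ D.V.valuation D.x' ≤ 1 ∧
      (∀ j, 2 ≤ j → D.V.valuation (D.HΩ.coeff j) < 1) ∧ (∀ j, D.V.valuation (D.HΩ.coeff j) ≤ 1) ∧
      D.V.valuation ((derivative D.HΩ).eval D.x') = 1 ∧
      (∀ s : Ω, D.HΩ.IsRoot s → s ≠ D.x' → 1 < D.V.valuation s) := hrest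
  exact ⟨hrest'.1, hrest'.2.2.2.2.2.1, hrest'.2.2.2.2.2.2.1⟩

/-- `H(x′) = 0`. [folklore] -/
theorem eval_HΩ_x' : D.HΩ.eval D.x' = 0 := D.henselData.1

/-- `|H′(x′)| = 1`. [folklore] -/
theorem valuation_derivative_HΩ_x' : D.V.valuation ((derivative D.HΩ).eval D.x') = 1 :=
  D.henselData.2.2

/-- `H′(x′) ≠ 0`. [folklore] -/
theorem eval_derivative_HΩ_x'_ne_zero : (derivative D.HΩ).eval D.x' ≠ 0 := fun h0 => by
  have h := D.valuation_derivative_HΩ_x'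
  rw [h0, map_zero] at h
  exact zero_ne_one h

/-- `HR(x′) = 0`. [folklore] -/
theorem aeval_x'_HR : aeval D.x' D.HR = 0 := by
  rw [aeval_def, ← eval_map, D.HR_map, D.eval_HΩ_x']

/-- `HR′(x′) ≠ 0`. [folklore] -/
theorem aeval_x'_derivative_HR_ne_zero : aeval D.x' (derivative D.HR) ≠ 0 := by
  rw [aeval_x'_derivative_HR]
  exact D.eval_derivative_HΩ_x'_ne_zero

/-! ### The second Hensel chart `T₂ = T₁[x′, u₂]` -/

/-- **The second Hensel chart**: an étale `T₁`-subalgebra `T ⊆ O_V` of `Ω` with `x′ ∈ T`,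
generated over `T₁` by `x′` and a unit `u₂` of value `1` with `u₂ · H′(x′) = 1`. [folklore] -/
theorem exists_T₂ : ∃ (T : Subalgebra D.R₂ Ω) (u : Ω), Algebra.Etale D.R₂ T ∧ D.x' ∈ T ∧ u ∈ T ∧
    T = Algebra.adjoin D.R₂ ({D.x', u} : Set Ω) ∧ u * (derivative D.HΩ).eval D.x' = 1 ∧
    T.toSubring ≤ D.V.toSubring ∧ D.V.valuation u = 1 := by
  haveI : IsIntegrallyClosed D.R₂ := D.isIntegrallyClosed_R₂
  obtain ⟨T, u, het, hx'T, huT, hTeq, hurel, -, hW⟩ :=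
    exists_etaleChart_of_root (R := D.R₂) (L := Ω) Subtype.val_injective D.HR D.x' D.aeval_x'_HR
      D.aeval_x'_derivative_HR_ne_zero
  rw [aeval_x'_derivative_HR] at hurel
  obtain ⟨hTV, hvu⟩ := hW D.V D.algebraMap_R₂_mem_V D.x'_mem_V
    (by rw [aeval_x'_derivative_HR]; exact D.valuation_derivative_HΩ_x')
  exact ⟨T, u, het, hx'T, huT, hTeq, hurel, hTV, hvu⟩

/-- The second Hensel chart `T₂`. [folklore] -/
def T₂ : Subalgebra D.R₂ Ω := D.exists_T₂.choose

/-- Its unit `u₂`. [folklore] -/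
def u₂ : Ω := D.exists_T₂.choose_spec.choose

/-- The specification of `(T₂, u₂)`. [folklore] -/
theorem T₂_spec : Algebra.Etale D.R₂ D.T₂ ∧ D.x' ∈ D.T₂ ∧ D.u₂ ∈ D.T₂ ∧
    D.T₂ = Algebra.adjoin D.R₂ ({D.x', D.u₂} : Set Ω) ∧ D.u₂ * (derivative D.HΩ).eval D.x' = 1 ∧
    D.T₂.toSubring ≤ D.V.toSubring ∧ D.V.valuation D.u₂ = 1 :=
  D.exists_T₂.choose_spec.choose_spec

/-- `T₂` is étale over `R₂ = T₁`. [folklore] -/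
theorem etale_T₂ : Algebra.Etale D.R₂ D.T₂ := D.T₂_spec.1

/-- `x′ ∈ T₂`. [folklore] -/
theorem x'_mem_T₂ : D.x' ∈ D.T₂ := D.T₂_spec.2.1

/-- `u₂ ∈ T₂`. [folklore] -/
theorem u₂_mem_T₂ : D.u₂ ∈ D.T₂ := D.T₂_spec.2.2.1

/-- `T₂ = T₁[x′, u₂]`. [folklore] -/
theorem T₂_eq_adjoin : D.T₂ = Algebra.adjoin D.R₂ ({D.x', D.u₂} : Set Ω) := D.T₂_spec.2.2.2.1

/-- `u₂ · H′(x′) = 1`. [folklore] -/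
theorem u₂_mul_derivative : D.u₂ * (derivative D.HΩ).eval D.x' = 1 := D.T₂_spec.2.2.2.2.1

/-- `T₂ ⊆ O_V`. [folklore] -/
theorem T₂_le_V : D.T₂.toSubring ≤ D.V.toSubring := D.T₂_spec.2.2.2.2.2.1

/-- `|u₂| = 1`. [folklore] -/
theorem valuation_u₂ : D.V.valuation D.u₂ = 1 := D.T₂_spec.2.2.2.2.2.2

/-- `u₂ ≠ 0`. [folklore] -/
theorem u₂_ne_zero : D.u₂ ≠ 0 := fun h0 => by
  have h := D.valuation_u₂
  rw [h0, map_zero] at h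
  exact zero_ne_one h

/-- `T₁ ⊆ T₂`. [folklore] -/
theorem mem_T₂_of_mem_T₁ {w : Ω} (hw : w ∈ D.T₁) : w ∈ D.T₂ := D.T₂.algebraMap_mem ⟨w, hw⟩

/-- `N″ ⊆ T₂`. [folklore] -/
theorem mem_T₂_of_mem_N'' {w : Ω} (hw : w ∈ D.N'') : w ∈ D.T₂ :=
  D.mem_T₂_of_mem_T₁ (D.mem_T₁_of_mem_N'' hw)

/-- `k° ↦ T₂`. [folklore] -/
theorem algebraMap_mem_T₂_of_mem_Ok {c₀ : k} (hc₀ : c₀ ∈ D.Ok) : algebraMap k Ω c₀ ∈ D.T₂ :=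
  D.mem_T₂_of_mem_N'' (D.algebraMap_mem_N''_of_mem_Ok hc₀)

/-- `y₀ ∈ T₂`. [folklore] -/
theorem y₀_mem_T₂ : D.y₀ ∈ D.T₂ := D.mem_T₂_of_mem_T₁ D.y₀_mem_T₁

/-- **The centre lies on the `K`-side chart**: `a = x − c x′ ∈ T₂`. [folklore] -/
theorem a_mem_T₂ : D.a ∈ D.T₂ := by
  rw [D.a_eq]
  exact sub_mem (D.mem_T₂_of_mem_N'' D.xΩ_mem_N'')
    (mul_mem (D.mem_T₂_of_mem_N'' D.cΩ_mem_N'') D.x'_mem_T₂)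

/-- `T₂` is integrally closed (étale over the integrally closed `R₂`). [folklore] -/
theorem isIntegrallyClosed_T₂ : IsIntegrallyClosed D.T₂ := by
  haveI := D.etale_T₂
  haveI : IsIntegrallyClosed D.R₂ := D.isIntegrallyClosed_R₂
  exact isIntegrallyClosed_of_etale (R := D.R₂) (T := D.T₂) fun a b hab => Subtype.ext (by
    have := congrArg (fun w : D.T₂ => (w : Ω)) hab
    exact this)

/-- `T₂` lies in every subring containing `T₁`, `x′`, `u₂`. [folklore] -/
theorem T₂_le_of_mem {G : Subring Ω} (hT₁ : D.T₁.toSubring ≤ G) (hx' : D.x' ∈ G) (hu₂ : D.u₂ ∈ G) :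
    D.T₂.toSubring ≤ G := by
  let G' : Subalgebra D.R₂ Ω :=
    { G with
      algebraMap_mem' := fun r => hT₁ r.2 }
  have h : Algebra.adjoin D.R₂ ({D.x', D.u₂} : Set Ω) ≤ G' := by
    refine Algebra.adjoin_le ?_
    rintro w (rfl | rfl)
    · exact hx'
    · exact hu₂
  intro w hw
  rw [T₂_eq_adjoin] at hw
  exact h hw

/-! ### The constants `m = k(y₀, a)`: fraction forms and the separating constant -/

/-- **Fraction forms of constants**: every `z ∈ m = k(y₀, a)` satisfies `d z ∈ T₂` for some
`d ∈ k° ∖ 0`. [folklore] -/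
theorem exists_mul_mem_T₂_of_mem_m {z : Ω} (hz : z ∈ D.m) :
    ∃ d ∈ D.Ok, d ≠ 0 ∧ algebraMap k Ω d * z ∈ D.T₂ := by
  have halg : ∀ w ∈ ({D.y₀, D.a} : Set Ω), IsAlgebraic k w := by
    rintro w (rfl | hw)
    · exact D.hy₀int.isAlgebraic
    · rw [Set.mem_singleton_iff.mp hw]; exact D.haint.isAlgebraic
  have hz' : z ∈ Algebra.adjoin k ({D.y₀, D.a} : Set Ω) := by
    rw [← IntermediateField.adjoin_toSubalgebra_of_isAlgebraic halg]
    exact hz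
  clear hz
  induction hz' using Algebra.adjoin_induction with
  | mem w hw =>
    refine ⟨1, D.Ok.one_mem, one_ne_zero, ?_⟩
    rw [map_one, one_mul]
    rcases hw with rfl | hw
    · exact D.y₀_mem_T₂
    · rw [Set.mem_singleton_iff.mp hw]; exact D.a_mem_T₂
  | algebraMap r =>
    by_cases hr : r ∈ D.Ok
    · refine ⟨1, D.Ok.one_mem, one_ne_zero, ?_⟩
      rw [map_one, one_mul]
      exact D.algebraMap_mem_T₂_of_mem_Ok hr
    · have hr0 : r ≠ 0 := fun h0 => hr (by rw [h0]; exact D.Ok.zero_mem)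
      have hrinv : r⁻¹ ∈ D.Ok := by
        rcases D.Ok.mem_or_inv_mem r with h | h
        · exact absurd h hr
        · exact h
      refine ⟨r⁻¹, hrinv, inv_ne_zero hr0, ?_⟩
      rw [← map_mul, inv_mul_cancel₀ hr0, map_one]
      exact D.T₂.one_mem
  | add w w' _ _ hw hw' =>
    obtain ⟨d, hd, hd0, hdw⟩ := hw
    obtain ⟨d', hd', hd0', hdw'⟩ := hw'
    refine ⟨d * d', mul_mem hd hd', mul_ne_zero hd0 hd0', ?_⟩
    rw [mul_add]
    refine add_mem ?_ ?_
    · have : algebraMap k Ω (d * d') * w = algebraMap k Ω d' * (algebraMap k Ω d * w) := by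
        rw [map_mul]; ring
      rw [this]
      exact mul_mem (D.algebraMap_mem_T₂_of_mem_Ok hd') hdw
    · have : algebraMap k Ω (d * d') * w' = algebraMap k Ω d * (algebraMap k Ω d' * w') := by
        rw [map_mul]; ring
      rw [this]
      exact mul_mem (D.algebraMap_mem_T₂_of_mem_Ok hd) hdw'
  | mul w w' _ _ hw hw' =>
    obtain ⟨d, hd, hd0, hdw⟩ := hw
    obtain ⟨d', hd', hd0', hdw'⟩ := hw'
    refine ⟨d * d', mul_mem hd hd', mul_ne_zero hd0 hd0', ?_⟩
    have : algebraMap k Ω (d * d') * (w * w') = (algebraMap k Ω d * w) * (algebraMap k Ω d' * w') := by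
      rw [map_mul]; ring
    rw [this]
    exact mul_mem hdw hdw'

/-- **Constants on an étale chart valuatively**: for an étale `T₁`-subalgebra `T` of `Ω`
containing `T₂`, an element `z ∈ m` lying in every valuation ring over `T` lies in `T`.
[folklore] -/
theorem mem_of_mem_m_of_forall {T : Subalgebra D.R₂ Ω} (het : Algebra.Etale D.R₂ T)
    (hT₂ : D.T₂ ≤ T) {z : Ω} (hz : z ∈ D.m)
    (hval : ∀ W : ValuationSubring Ω, T.toSubring ≤ W.toSubring → z ∈ W) : z ∈ T := by
  haveI : Algebra.Etale D.R₂ T := het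
  haveI : IsIntegrallyClosed D.R₂ := D.isIntegrallyClosed_R₂
  obtain ⟨d, hd, hd0, hdz⟩ := D.exists_mul_mem_T₂_of_mem_m hz
  exact RelCurveChart.mem_of_forall_valuationSubring_of_mul_mem (R := D.R₂) Subtype.val_injective T
    hval (hT₂ (D.algebraMap_mem_T₂_of_mem_Ok hd)) ((_root_.map_ne_zero _).mpr hd0) (hT₂ hdz)

/-- `μ ∈ T₂`. [folklore] -/
theorem μ_mem_T₂ : D.μ ∈ D.T₂ :=
  D.mem_of_mem_m_of_forall D.etale_T₂ le_rfl D.μ_mem_m fun W hW =>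
    D.μ_mem_of W fun _ hc₀ => hW (D.algebraMap_mem_T₂_of_mem_Ok hc₀)

/-- The chart `T₃ = T₂[1/μ]`. [folklore] -/
def T₃ : Subalgebra D.R₂ Ω := locAway D.T₂ D.μ D.μ_mem_T₂

/-- `T₃` is étale over `R₂ = T₁`. [folklore] -/
theorem etale_T₃ : Algebra.Etale D.R₂ D.T₃ := by
  haveI := D.etale_T₂
  exact RelCurveChart.etale_locAway_of_etale D.μ_ne_zero

/-- `T₂ ≤ T₃`. [folklore] -/
theorem T₂_le_T₃ : D.T₂ ≤ D.T₃ := le_locAway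

/-- `T₃ ⊆ O_V`. [folklore] -/
theorem T₃_le_V : D.T₃.toSubring ≤ D.V.toSubring := locAway_le_valuationSubring D.T₂_le_V D.valuation_μ

/-- **The sheet property of `T₃`**: a valuation ring `W ⊇ T₃` contains `m` or induces
`m ∩ O_V` on `m`. [folklore] -/
theorem sheet (W : ValuationSubring Ω) (hW : D.T₃.toSubring ≤ W.toSubring) :
    (∀ z ∈ D.m, z ∈ W) ∨ (∀ z ∈ D.m, z ∈ W ↔ z ∈ D.V) := by
  have hk : ∀ c₀ ∈ D.Ok, algebraMap k Ω c₀ ∈ W := fun c₀ hc₀ =>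
    hW (D.T₂_le_T₃ (D.algebraMap_mem_T₂_of_mem_Ok hc₀))
  have hWμ : W.valuation D.μ = 1 := by
    have h1 : D.μ ∈ W := hW (D.T₂_le_T₃ D.μ_mem_T₂)
    have h2 : D.μ⁻¹ ∈ W := hW (inv_mem_locAway (hf := D.μ_mem_T₂) D.μ_ne_zero)
    refine le_antisymm ((W.valuation_le_one_iff _).mpr h1) ?_
    have h3 := (W.valuation_le_one_iff _).mpr h2
    rwa [map_inv₀, inv_le_one₀ ((Valuation.pos_iff _).mpr D.μ_ne_zero)] at h3
  exact D.μ_dichotomy W hk hWμ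

/-- **`m° ⊆ T₃`.** [folklore] -/
theorem mem_T₃_of_mem_Om {z : Ω} (hz : z ∈ D.Om) : z ∈ D.T₃ := by
  obtain ⟨hzV, hzm⟩ := D.mem_Om_iff.mp hz
  exact D.mem_of_mem_m_of_forall D.etale_T₃ D.T₂_le_T₃ hzm fun W hW => by
    rcases D.sheet W hW with h | h
    · exact h z hzm
    · exact (h z hzm).mpr hzV

/-! ### The `K`-side chart `T_A = T₃[1/u_E]` -/

/-- `T₃` as an `m°`-subalgebra of `Ω` (same subring). [folklore] -/
def T₃Om : Subalgebra D.Om Ω :=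
  { D.T₃.toSubring with
    algebraMap_mem' := fun c => D.mem_T₃_of_mem_Om c.2 }

/-- `m°[x′] ⊆ T₃`. [folklore] -/
theorem adjoin_x'_le_T₃Om : Algebra.adjoin D.Om ({D.x'} : Set Ω) ≤ D.T₃Om :=
  Algebra.adjoin_le (Set.singleton_subset_iff.mpr (D.T₂_le_T₃ D.x'_mem_T₂))

/-- `u_E ∈ T₃`. [folklore] -/
theorem uE_mem_T₃ : D.uE ∈ D.T₃ := D.adjoin_x'_le_T₃Om D.huE

/-- **The `K`-side chart** `T_A = T₃[1/u_E]`, an étale `R₂`-subalgebra of `Ω`. [folklore] -/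
def TA : Subalgebra D.R₂ Ω := locAway D.T₃ D.uE D.uE_mem_T₃

/-- `T_A` is étale over `R₂ = T₁`. [folklore] -/
theorem etale_TA : Algebra.Etale D.R₂ D.TA := by
  haveI := D.etale_T₃
  exact RelCurveChart.etale_locAway_of_etale D.uE_ne_zero

/-- `T₃ ≤ T_A`. [folklore] -/
theorem T₃_le_TA : D.T₃ ≤ D.TA := le_locAway

/-- `T_A ⊆ O_V`. [folklore] -/
theorem TA_le_V : D.TA.toSubring ≤ D.V.toSubring := locAway_le_valuationSubring D.T₃_le_V D.hvuE

/-- `T_A` is integrally closed. [folklore] -/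
theorem isIntegrallyClosed_TA : IsIntegrallyClosed D.TA := by
  haveI := D.etale_TA
  haveI : IsIntegrallyClosed D.R₂ := D.isIntegrallyClosed_R₂
  exact isIntegrallyClosed_of_etale (R := D.R₂) (T := D.TA) fun a b hab => Subtype.ext (by
    have := congrArg (fun w : D.TA => (w : Ω)) hab
    exact this)

/-- `m° ⊆ T_A`. [folklore] -/
theorem mem_TA_of_mem_Om {z : Ω} (hz : z ∈ D.Om) : z ∈ D.TA := D.T₃_le_TA (D.mem_T₃_of_mem_Om hz)

/-- `x′ ∈ T_A`. [folklore] -/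
theorem x'_mem_TA : D.x' ∈ D.TA := D.T₃_le_TA (D.T₂_le_T₃ D.x'_mem_T₂)

/-- `y₀ ∈ T_A`. [folklore] -/
theorem y₀_mem_TA : D.y₀ ∈ D.TA := D.T₃_le_TA (D.T₂_le_T₃ D.y₀_mem_T₂)

/-- `a ∈ T_A`. [folklore] -/
theorem a_mem_TA : D.a ∈ D.TA := D.T₃_le_TA (D.T₂_le_T₃ D.a_mem_T₂)

/-- `N″ ⊆ T_A`. [folklore] -/
theorem mem_TA_of_mem_N'' {w : Ω} (hw : w ∈ D.N'') : w ∈ D.TA :=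
  D.T₃_le_TA (D.T₂_le_T₃ (D.mem_T₂_of_mem_N'' hw))

/-- `N ↦ T_A`. [folklore] -/
theorem algebraMap_mem_TA {w : L₁} (hw : w ∈ D.N) : algebraMap L₁ Ω w ∈ D.TA :=
  D.mem_TA_of_mem_N'' (D.algebraMap_mem_N'' hw)

/-- `u_E⁻¹ ∈ T_A`. [folklore] -/
theorem uE_inv_mem_TA : D.uE⁻¹ ∈ D.TA := inv_mem_locAway D.uE_ne_zero

/-- `T_A` as an `m°`-subalgebra of `Ω` (same subring). [folklore] -/
def TAOm : Subalgebra D.Om Ω :=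
  { D.TA.toSubring with
    algebraMap_mem' := fun c => D.mem_TA_of_mem_Om c.2 }

/-- Membership in `TAOm` is membership in `TA`. [folklore] -/
theorem mem_TAOm_iff {w : Ω} : w ∈ D.TAOm ↔ w ∈ D.TA := Iff.rfl

/-- `m°[x′] ⊆ T_A`. [folklore] -/
theorem adjoin_x'_le_TAOm : Algebra.adjoin D.Om ({D.x'} : Set Ω) ≤ D.TAOm :=
  Algebra.adjoin_le (Set.singleton_subset_iff.mpr D.x'_mem_TA)

/-- **The disc chart `B = m°[x′][1/u_E]` lies in `T_A`.** [folklore] -/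
theorem mem_TA_of_mem_locAway {q : Ω}
    (hq : q ∈ locAway (Algebra.adjoin D.Om ({D.x'} : Set Ω)) D.uE D.huE) : q ∈ D.TA := by
  obtain ⟨n, hn⟩ := hq
  have h1 : q * D.uE ^ n ∈ D.TA := D.adjoin_x'_le_TAOm hn
  have h2 : q = (q * D.uE ^ n) * (D.uE⁻¹) ^ n := by
    rw [inv_pow, mul_assoc, mul_inv_cancel₀ (pow_ne_zero n D.uE_ne_zero), mul_one]
  rw [h2]
  exact D.TA.mul_mem h1 (D.TA.pow_mem D.uE_inv_mem_TA n)

/-- The coefficients of `f` lie in `T_A`. [folklore] -/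
theorem coeff_f_mem_TA (i : ℕ) : D.f.coeff i ∈ D.TA := D.mem_TA_of_mem_locAway (D.hfcoef i)

/-- `η` is integral over `T_A` (the monic `f` has its coefficients in `T_A`). [folklore] -/
theorem isIntegral_η : IsIntegral D.TA D.η := by
  have hl : D.f ∈ Polynomial.lifts (algebraMap D.TA Ω) := by
    refine (Polynomial.lifts_iff_coeff_lifts _).mpr fun i => ?_
    exact ⟨⟨D.f.coeff i, D.coeff_f_mem_TA i⟩, rfl⟩
  obtain ⟨fT, hfT, -, hfTmon⟩ := Polynomial.lifts_and_degree_eq_and_monic hl D.hfmon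
  refine ⟨fT, hfTmon, ?_⟩
  rw [← Polynomial.eval_map, hfT]
  exact D.hfη

/-- `T₁ ⊆ T_A`. [folklore] -/
theorem mem_TA_of_mem_T₁ {w : Ω} (hw : w ∈ D.T₁) : w ∈ D.TA :=
  D.T₃_le_TA (D.T₂_le_T₃ (D.T₂.algebraMap_mem ⟨w, hw⟩))

/-- `T_A` as an `N`-subalgebra of `Ω` (same subring). [folklore] -/
def TAN : Subalgebra D.N Ω :=
  { D.TA.toSubring with
    algebraMap_mem' := fun n => D.algebraMap_mem_TA n.2 }

/-- Membership in `TAN` is membership in `TA`. [folklore] -/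
theorem mem_TAN_iff {w : Ω} : w ∈ D.TAN ↔ w ∈ D.TA := Iff.rfl

/-- `N[y₀, a] ⊆ T_A`. [folklore] -/
theorem adjoin_N_le_TAN : Algebra.adjoin D.N ({D.y₀, D.a} : Set Ω) ≤ D.TAN := by
  refine Algebra.adjoin_le ?_
  rintro w (rfl | hw)
  · exact D.y₀_mem_TA
  · rw [Set.mem_singleton_iff.mp hw]; exact D.a_mem_TA

/-- **`η ∈ T_A`** (integrality over the normal `T_A` and the fraction form over `N[y₀, a]`).
[folklore] -/
theorem η_mem_TA : D.η ∈ D.TA := by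
  haveI := D.isIntegrallyClosed_TA
  obtain ⟨n, hnN, hn0, hn⟩ := D.hηfrac
  exact mem_of_isIntegral_of_mul_mem D.TA D.isIntegral_η (D.algebraMap_mem_TA hnN)
    ((_root_.map_ne_zero _).mpr hn0) (D.adjoin_N_le_TAN hn)

/-! ### Smoothness of `T_A` over `N`, and the generators of `T_A` -/

/-- `T_A` is smooth over `N` (`N → N″` smooth, `N″ → T₁` étale, `T₁ → T_A` étale). [folklore] -/
theorem smooth_TAN : Algebra.Smooth D.N D.TAN := by
  -- `N → N″ → T₁` is smooth
  haveI hsmN'' : Algebra.Smooth D.N D.N'' := D.smooth_N''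
  haveI := D.etale_T₁
  haveI : Algebra.FormallyEtale D.N'' D.T₁ := D.etale_T₁.formallyEtale
  haveI : Algebra.FinitePresentation D.N'' D.T₁ := D.etale_T₁.finitePresentation
  haveI : Algebra.Smooth D.N'' D.T₁ := ⟨inferInstance, inferInstance⟩
  have hT₁ : Algebra.Smooth D.N D.T₁ := Algebra.Smooth.comp D.N D.N'' D.T₁
  -- `R₂ = T₁ → T_A` is smooth (étale); transport the base along `T₁ ≅ R₂`
  haveI := D.etale_TA
  haveI : Algebra.FormallyEtale D.R₂ D.TA := D.etale_TA.formallyEtale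
  haveI : Algebra.FinitePresentation D.R₂ D.TA := D.etale_TA.finitePresentation
  haveI hR₂TA : Algebra.Smooth D.R₂ D.TA := ⟨inferInstance, inferInstance⟩
  letI algR₂ : Algebra D.R₂ D.TAN := (inferInstance : Algebra D.R₂ D.TA)
  have hsmR₂TAN : @Algebra.Smooth D.R₂ _ D.TAN _ algR₂ := hR₂TA
  letI algT₁ : Algebra D.T₁ D.TAN :=
    ((Subring.inclusion (show D.T₁.toSubring ≤ D.TAN.toSubring from
      fun w hw => D.mem_TA_of_mem_T₁ hw))).toAlgebra
  haveI hT₁TA : @Algebra.Smooth D.T₁ _ D.TAN _ algT₁ :=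
    @Algebra.Smooth.of_ringEquiv_base D.R₂ D.T₁ D.TAN _ _ _ algR₂ algT₁ D.eR₂.symm
      (fun b => Subtype.ext rfl) hsmR₂TAN
  -- compose over `N`
  haveI : IsScalarTower D.N D.T₁ D.TAN := IsScalarTower.of_algebraMap_eq fun _ => rfl
  haveI := hT₁
  exact Algebra.Smooth.comp D.N D.T₁ D.TAN

/-- `T_A ⊆ O_V`, for `TAN`. [folklore] -/
theorem TAN_le_V : D.TAN.toSubring ≤ D.V.toSubring := fun _ hw => D.TA_le_V hw

/-- **Generators of `T_A`**: `T_A` lies in every subring of `Ω` containing `N″`, `z₀`, `u₁`,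
`x′`, `u₂`, `μ⁻¹` and `u_E⁻¹`. [folklore] -/
theorem TA_le_of_mem {G : Subring Ω} (hN : D.N''.toSubring ≤ G) (hz₀ : D.z₀ ∈ G) (hu₁ : D.u₁ ∈ G)
    (hx' : D.x' ∈ G) (hu₂ : D.u₂ ∈ G) (hμ : D.μ⁻¹ ∈ G) (huE : D.uE⁻¹ ∈ G) :
    D.TA.toSubring ≤ G := by
  have hT₁ : D.T₁.toSubring ≤ G := D.T₁_le_of_mem hN hz₀ hu₁
  have hT₂ : D.T₂.toSubring ≤ G := D.T₂_le_of_mem hT₁ hx' hu₂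
  have hT₃ : D.T₃.toSubring ≤ G := by
    rintro w ⟨n, hn⟩
    have h1 : w * D.μ ^ n ∈ G := hT₂ hn
    have h2 : w = (w * D.μ ^ n) * (D.μ⁻¹) ^ n := by
      rw [inv_pow, mul_assoc, mul_inv_cancel₀ (pow_ne_zero n D.μ_ne_zero), mul_one]
    rw [h2]
    exact G.mul_mem h1 (G.pow_mem hμ n)
  rintro w ⟨n, hn⟩
  have h1 : w * D.uE ^ n ∈ G := hT₃ hn
  have h2 : w = (w * D.uE ^ n) * (D.uE⁻¹) ^ n := by
    rw [inv_pow, mul_assoc, mul_inv_cancel₀ (pow_ne_zero n D.uE_ne_zero), mul_one]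
  rw [h2]
  exact G.mul_mem h1 (G.pow_mem huE n)

end AlgClosed

end RoofDatum

end Literature.AlgebraicGeometry.Resolution

end
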